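import Summits.Ventures.YMGap.FlowData.RectTubeTransferPositivity
import Summits.Ventures.YMGap.FlowData.TubeSchurTest
import Literature.Analysis.OperatorTheory.PositivityImproving
import HarnessLib

/-!
# Venture YMGap, track Y3 FLOW-DATA — the rectangular transfer operator near `β = 0` is within
# `e^{|J| n (#P+N)} − 1` of the rank-one projection onto the constants; first-order perturbation of a rank-one
# projection in a real Hilbert space (theorems only; tools for `RectTubeMassGapPrimeDivergence` / `RectTubeFluxEnergyDivergence`)

HONEST FRAMING: venture file of the cell `pub-ymgap` (QuantumFields programme), track Y3; elementary operator theory and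
one pointwise kernel estimate on a FINITE rectangular torus.  No number of the FLOW-TABLE, no row, nothing about `L → ∞`,
the continuum, or a mass gap in the thermodynamic sense.

* `one_sub_le_norm_of_near_rankOne`, `norm_le_one_add_of_near_rankOne`, **`norm_apply_le_of_near_rankOne`** — if
  `‖Tψ − ⟪e,ψ⟫e‖ ≤ η‖ψ‖` for a unit vector `e`, `0 ≤ η ≤ ¼`, and `Tφ₀ = ‖T‖φ₀` with `‖φ₀‖ = 1`, then `1 − η ≤ ‖T‖ ≤ 1 + η`
  and `‖Tψ‖ ≤ 5η‖ψ‖` for every `ψ ⊥ φ₀` (the component of `φ₀` orthogonal to `e` has norm `≤ 2η/‖T‖`);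
* `exp_sub_one_le_mul_of_exp_le` — `e^x − 1 ≤ (5/4)x` for `0 ≤ x` with `e^x ≤ 5/4`; `sq_integral_abs_le_integral_sq` —
  `(∫|ψ|)² ≤ ∫ψ²` on a probability space;
* **`abs_rectSliceKernel_sub_one_le`** — `|K(a,b) − 1| ≤ e^{|J| n (#P+N)} − 1` for the slice kernel of a unitary `ρ`
  (`#P = #sites·k(k−1)/2` spatial plaquettes, `N = #sites·k` links; `|Re tr ρ| ≤ n`);
* **`norm_rectTubeTransferOperator_sub_rankOne_le`** — `‖Tψ − ⟪1,ψ⟫1‖ ≤ (e^{|J| n (#P+N)} − 1)‖ψ‖`;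
* `two_sub_exp_le_norm_rectTubeTransferOperator` — `2 − e^{|J| n (#P+N)} ≤ ‖T‖`.

References: T. Kato, *Perturbation Theory for Linear Operators* (1966), Ch. II §1 [folklore]; K. Osterwalder, E. Seiler,
Ann. Phys. 110 (1978) 440 §3 [cite: OsterwalderSeilerAnnPhys1978, §3]; I. Montvay, G. Münster (1994) §3.2.6
[cite: MontvayMunster1994, §3.2.6].
-/

noncomputable section

open scoped BigOperators ENNReal InnerProductSpace
open MeasureTheory Filter Function Topology
open Literature.MathematicalPhysics.QuantumFieldTheory Literature.Analysis.OperatorTheory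
open Literature.MathematicalPhysics.QuantumLattice (RectTorusSite)
open Literature.Barriers.QuantumFields

namespace Summit.Ventures.YMGap.FlowData

/-! ### First-order perturbation of a rank-one projection (abstract real Hilbert space) -/

section Abstract

variable {H : Type*} [NormedAddCommGroup H] [InnerProductSpace ℝ H]

/-- If `‖Tψ − ⟪e,ψ⟫e‖ ≤ η‖ψ‖` for a unit vector `e`, then `1 − η ≤ ‖T‖` (test on `e`). [folklore] -/
theorem one_sub_le_norm_of_near_rankOne (T : H →L[ℝ] H) {e : H} (he : ‖e‖ = 1) {η : ℝ}
    (hT : ∀ ψ, ‖T ψ - (@inner ℝ _ _ e ψ) • e‖ ≤ η * ‖ψ‖) : 1 - η ≤ ‖T‖ := by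
  have h1 := hT e
  rw [real_inner_self_eq_norm_sq, he, one_pow, one_smul, mul_one] at h1
  have h2 : ‖e‖ - ‖T e‖ ≤ ‖T e - e‖ := by
    rw [norm_sub_rev]; exact norm_sub_norm_le e (T e)
  have h3 : ‖T e‖ ≤ ‖T‖ := by
    have := T.le_opNorm e
    rwa [he, mul_one] at this
  linarith

/-- If `‖Tψ − ⟪e,ψ⟫e‖ ≤ η‖ψ‖` for a unit vector `e`, then `‖T‖ ≤ 1 + η`. [folklore] -/
theorem norm_le_one_add_of_near_rankOne (T : H →L[ℝ] H) {e : H} (he : ‖e‖ = 1) {η : ℝ} (hη0 : 0 ≤ η)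
    (hT : ∀ ψ, ‖T ψ - (@inner ℝ _ _ e ψ) • e‖ ≤ η * ‖ψ‖) : ‖T‖ ≤ 1 + η := by
  refine ContinuousLinearMap.opNorm_le_bound T (by linarith) fun ψ => ?_
  have h1 : ‖(@inner ℝ _ _ e ψ) • e‖ ≤ ‖ψ‖ := by
    rw [norm_smul, he, mul_one]
    have := abs_real_inner_le_norm e ψ
    rwa [he, one_mul] at this
  calc ‖T ψ‖ = ‖(T ψ - (@inner ℝ _ _ e ψ) • e) + (@inner ℝ _ _ e ψ) • e‖ := by rw [sub_add_cancel]
    _ ≤ ‖T ψ - (@inner ℝ _ _ e ψ) • e‖ + ‖(@inner ℝ _ _ e ψ) • e‖ := norm_add_le _ _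
    _ ≤ η * ‖ψ‖ + ‖ψ‖ := add_le_add (hT ψ) h1
    _ = (1 + η) * ‖ψ‖ := by ring

/-- **First-order perturbation of a rank-one projection.**  If `‖Tψ − ⟪e,ψ⟫e‖ ≤ η‖ψ‖` (`‖e‖ = 1`, `0 ≤ η ≤ ¼`) and
`Tφ₀ = ‖T‖φ₀` with `‖φ₀‖ = 1`, then `‖Tψ‖ ≤ 5η‖ψ‖` for every `ψ ⊥ φ₀`: the component of `φ₀` orthogonal to `e` has norm
`≤ 2η/‖T‖ ≤ 8η/3`, so `|⟪e,φ₀⟩| ≥ 2/3`, `|⟪e,ψ⟩| ≤ 4η‖ψ‖`. [folklore] -/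
theorem norm_apply_le_of_near_rankOne (T : H →L[ℝ] H) {e : H} (he : ‖e‖ = 1) {φ₀ : H} (h0 : ‖φ₀‖ = 1)
    (heig : T φ₀ = ‖T‖ • φ₀) {η : ℝ} (hη0 : 0 ≤ η) (hη : η ≤ 1 / 4)
    (hT : ∀ ψ, ‖T ψ - (@inner ℝ _ _ e ψ) • e‖ ≤ η * ‖ψ‖) {ψ : H} (hψ : @inner ℝ _ _ φ₀ ψ = 0) :
    ‖T ψ‖ ≤ 5 * η * ‖ψ‖ := by
  set Λ : ℝ := ‖T‖ with hΛ
  set a : ℝ := @inner ℝ _ _ e φ₀ with ha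
  set w : H := φ₀ - a • e with hw
  have hΛlo : 1 - η ≤ Λ := one_sub_le_norm_of_near_rankOne T he hT
  have hΛhi : Λ ≤ 1 + η := norm_le_one_add_of_near_rankOne T he hη0 hT
  have hΛpos : 0 < Λ := by linarith
  -- `Λ w = (Tφ₀ − a e) + (a − Λ a) e`, so `Λ ‖w‖ ≤ 2η`
  have hw1 : Λ • w = (T φ₀ - a • e) + (a * (1 - Λ)) • e := by
    rw [hw, smul_sub, heig, smul_smul]
    have : (a * (1 - Λ)) • e = a • e - (Λ * a) • e := by rw [← sub_smul]; ring_nf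
    rw [this]; abel
  have ha1 : |a| ≤ 1 := by
    have := abs_real_inner_le_norm e φ₀
    rwa [he, h0, one_mul] at this
  have hwn : Λ * ‖w‖ ≤ 2 * η := by
    have h1 : ‖Λ • w‖ = Λ * ‖w‖ := by rw [norm_smul, Real.norm_eq_abs, abs_of_pos hΛpos]
    rw [← h1, hw1]
    have h2 := hT φ₀
    rw [h0, mul_one] at h2
    have h3 : ‖(a * (1 - Λ)) • e‖ ≤ η := by
      rw [norm_smul, he, mul_one, Real.norm_eq_abs, abs_mul]
      have h4 : |1 - Λ| ≤ η := abs_le.2 ⟨by linarith, by linarith⟩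
      calc |a| * |1 - Λ| ≤ 1 * η := mul_le_mul ha1 h4 (abs_nonneg _) zero_le_one
        _ = η := one_mul _
    linarith [norm_add_le (T φ₀ - a • e) ((a * (1 - Λ)) • e)]
  have hwle : ‖w‖ ≤ 8 * η / 3 := by
    have h34 : 3 / 4 ≤ Λ := by linarith
    have : 3 / 4 * ‖w‖ ≤ Λ * ‖w‖ := mul_le_mul_of_nonneg_right h34 (norm_nonneg _)
    linarith
  -- Pythagoras: `1 = a² + ‖w‖²`, hence `|a| ≥ 2/3`
  have hew : @inner ℝ _ _ e w = 0 := by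
    rw [hw, inner_sub_right, real_inner_smul_right, real_inner_self_eq_norm_sq, he, one_pow, mul_one, ← ha, sub_self]
  have hwe : @inner ℝ _ _ w e = 0 := by rw [real_inner_comm]; exact hew
  have hpy : 1 = a ^ 2 + ‖w‖ ^ 2 := by
    have h1 : φ₀ = a • e + w := by rw [hw, add_sub_cancel]
    have h2 : @inner ℝ _ _ (a • e + w) (a • e + w) = a ^ 2 + ‖w‖ ^ 2 := by
      rw [inner_add_left, inner_add_right, inner_add_right, real_inner_smul_left, real_inner_smul_left,
        real_inner_smul_right, real_inner_smul_right, hew, hwe, real_inner_self_eq_norm_sq,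
        real_inner_self_eq_norm_sq, he]
      ring
    rw [← h2, ← h1, real_inner_self_eq_norm_sq, h0, one_pow]
  have ha23 : 2 / 3 ≤ |a| := by
    have h1 : ‖w‖ ^ 2 ≤ (2 / 3) ^ 2 := by
      have : ‖w‖ ≤ 2 / 3 := by linarith
      exact pow_le_pow_left₀ (norm_nonneg _) this 2
    have h2 : (2 / 3 : ℝ) ^ 2 ≤ |a| ^ 2 := by rw [sq_abs]; nlinarith
    exact (pow_le_pow_iff_left₀ (by norm_num) (abs_nonneg _) two_ne_zero).1 h2
  -- `ψ ⊥ φ₀` forces `|⟪e,ψ⟫| ≤ 4η‖ψ‖`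
  have heψ : |@inner ℝ _ _ e ψ| ≤ 4 * η * ‖ψ‖ := by
    have h1 : a * @inner ℝ _ _ e ψ + @inner ℝ _ _ w ψ = 0 := by
      have h2 : φ₀ = a • e + w := by rw [hw, add_sub_cancel]
      rw [h2, inner_add_left, real_inner_smul_left] at hψ
      exact hψ
    have h2 : |a| * |@inner ℝ _ _ e ψ| ≤ 8 * η / 3 * ‖ψ‖ := by
      rw [← abs_mul, show a * @inner ℝ _ _ e ψ = -@inner ℝ _ _ w ψ by linarith, abs_neg]
      exact (abs_real_inner_le_norm w ψ).trans (mul_le_mul_of_nonneg_right hwle (norm_nonneg _))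
    have h3 : 2 / 3 * |@inner ℝ _ _ e ψ| ≤ |a| * |@inner ℝ _ _ e ψ| :=
      mul_le_mul_of_nonneg_right ha23 (abs_nonneg _)
    linarith
  calc ‖T ψ‖ = ‖(T ψ - (@inner ℝ _ _ e ψ) • e) + (@inner ℝ _ _ e ψ) • e‖ := by rw [sub_add_cancel]
    _ ≤ ‖T ψ - (@inner ℝ _ _ e ψ) • e‖ + ‖(@inner ℝ _ _ e ψ) • e‖ := norm_add_le _ _
    _ ≤ η * ‖ψ‖ + 4 * η * ‖ψ‖ := by
        refine add_le_add (hT ψ) ?_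
        rw [norm_smul, he, mul_one, Real.norm_eq_abs]; exact heψ
    _ = 5 * η * ‖ψ‖ := by ring

end Abstract

/-- `e^x − 1 ≤ x e^x` for `x ≥ 0` (from `1 − x ≤ e^{−x}`), in the form used for explicit rates: if moreover `e^x ≤ 5/4`
then `e^x − 1 ≤ (5/4)·x`. [folklore] -/
theorem exp_sub_one_le_mul_of_exp_le {x : ℝ} (hx : 0 ≤ x) (h : Real.exp x ≤ 5 / 4) : Real.exp x - 1 ≤ 5 / 4 * x := by
  have h1 : -x + 1 ≤ Real.exp (-x) := Real.add_one_le_exp (-x)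
  have h2 : Real.exp x * Real.exp (-x) = 1 := by rw [← Real.exp_add, add_neg_cancel, Real.exp_zero]
  have h3 : Real.exp x - 1 ≤ x * Real.exp x := by nlinarith [Real.exp_pos x, Real.exp_pos (-x)]
  nlinarith [Real.exp_pos x]

/-! ### The slice kernel near `β = 0` and the rank-one approximation of `T` -/

section Gap

variable {G : Type*} [Group G] [TopologicalSpace G] [IsTopologicalGroup G] [CompactSpace G]
  [MeasurableSpace G] [BorelSpace G] [SecondCountableTopology G] {n : ℕ} (ρ : G →* Matrix (Fin n) (Fin n) ℂ)
  (J : ℝ) {k : ℕ} {Ls : Fin k → ℕ} [∀ i, NeZero (Ls i)]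

omit [TopologicalSpace G] [IsTopologicalGroup G] [CompactSpace G] [BorelSpace G] [SecondCountableTopology G] in
/-- `(∫ |ψ|)² ≤ ∫ ψ²` for `ψ ∈ L²` of a probability space (the variance of `|ψ|` is non-negative). [folklore] -/
theorem sq_integral_abs_le_integral_sq {X : Type*} [MeasurableSpace X] {μ : Measure X} [IsProbabilityMeasure μ]
    (ψ : Lp ℝ 2 μ) : (∫ x, |ψ x| ∂μ) ^ 2 ≤ ∫ x, (ψ x) ^ 2 ∂μ := by
  set c : ℝ := ∫ x, |ψ x| ∂μ with hc
  have hint : Integrable (fun x => (ψ : X → ℝ) x) μ := (Lp.memLp ψ).integrable one_le_two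
  have hsq : Integrable (fun x => (ψ x) ^ 2) μ := (Lp.memLp ψ).integrable_sq
  have habs : Integrable (fun x => |ψ x|) μ := hint.abs
  have h0 : 0 ≤ ∫ x, (|ψ x| - c) ^ 2 ∂μ := integral_nonneg fun x => sq_nonneg _
  have h1 : ∫ x, (|ψ x| - c) ^ 2 ∂μ = (∫ x, (ψ x) ^ 2 ∂μ) - 2 * c * (∫ x, |ψ x| ∂μ) + c ^ 2 := by
    have h2 : (fun x => (|ψ x| - c) ^ 2) = fun x => ((ψ x) ^ 2 - 2 * c * |ψ x|) + c ^ 2 := by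
      funext x; rw [sub_sq, sq_abs]; ring
    have h3 : Integrable (fun x => (ψ x) ^ 2 - 2 * c * |ψ x|) μ := hsq.sub (habs.const_mul _)
    have h4 : Integrable (fun x => 2 * c * |ψ x|) μ := habs.const_mul _
    rw [h2, integral_add h3 (integrable_const _), integral_sub hsq h4, integral_const_mul, integral_const, smul_eq_mul,
      probReal_univ, one_mul]
  rw [h1, ← hc] at h0
  nlinarith

/-- **`|K(a,b) − 1| ≤ e^{|J| n (#P+N)} − 1`** for the rectangular slice kernel of a unitary `ρ` (`#P = #sites·k(k−1)/2`
spatial plaquettes, `N = #sites·k` spatial links = temporal plaquettes; `|Re tr ρ| ≤ n`). [folklore] -/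
theorem abs_rectSliceKernel_sub_one_le (hρ : Continuous ρ) (hρu : ∀ g, ρ g ∈ Matrix.unitaryGroup (Fin n) ℂ)
    (a b : RectSlice Ls G) :
    |rectSliceKernel (Ls := Ls) ρ J J a b - 1| ≤
      Real.exp (|J| * n * (Fintype.card (RectTorusSite Ls) * Fintype.card {p : Fin k × Fin k // p.1 < p.2} +
        Fintype.card (RectTorusSite Ls × Fin k))) - 1 := by
  set P : ℝ := (Fintype.card (RectTorusSite Ls) : ℝ) * (Fintype.card {p : Fin k × Fin k // p.1 < p.2} : ℝ) with hP
  set N : ℝ := (Fintype.card (RectTorusSite Ls × Fin k) : ℝ) with hN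
  -- `|mag| ≤ n P`, `|elec| ≤ n N`
  have htr : ∀ g : G, |(ρ g).trace.re| ≤ n := fun g =>
    (Complex.abs_re_le_norm _).trans (FiniteTemperature.norm_trace_le_of_mem_unitaryGroup (hρu _))
  have hmag : ∀ c : RectSlice Ls G, |rectMagSum (Ls := Ls) ρ c| ≤ n * P := by
    intro c
    unfold rectMagSum
    refine (Finset.abs_sum_le_sum_abs _ _).trans ?_
    refine (Finset.sum_le_sum fun x _ => (Finset.abs_sum_le_sum_abs _ _).trans
      (Finset.sum_le_sum fun p _ => htr _)).trans (le_of_eq ?_)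
    simp only [Finset.sum_const, Finset.card_univ, hP]
    ring
  have helec : ∀ E : RectTorusSite Ls → G, |rectElecSum (Ls := Ls) ρ a E b| ≤ n * N := by
    intro E
    unfold rectElecSum
    refine (Finset.abs_sum_le_sum_abs _ _).trans ?_
    refine (Finset.sum_le_sum fun x _ => (Finset.abs_sum_le_sum_abs _ _).trans
      (Finset.sum_le_sum fun i _ => htr _)).trans (le_of_eq ?_)
    simp only [Finset.sum_const, Finset.card_univ, hN, Fintype.card_prod, Fintype.card_fin]
    push_cast; ring
  -- the three factors lie in `[e^{-x}, e^{x}]`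
  have hm : ∀ c : RectSlice Ls G, |J / 2 * rectMagSum (Ls := Ls) ρ c| ≤ |J| * n * P / 2 := by
    intro c
    rw [abs_mul, abs_div, abs_two]
    have := mul_le_mul_of_nonneg_left (hmag c) (abs_nonneg J)
    linarith
  have hEint : ∀ E : RectTorusSite Ls → G, |J * rectElecSum (Ls := Ls) ρ a E b| ≤ |J| * n * N := by
    intro E
    rw [abs_mul]
    have := mul_le_mul_of_nonneg_left (helec E) (abs_nonneg J)
    linarith
  have hc1 : ∀ y : RectTorusSite Ls, Continuous fun E : RectTorusSite Ls → G => E y := fun y => continuous_apply y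
  have hEc : Continuous fun E : RectTorusSite Ls → G => Real.exp (J * rectElecSum (Ls := Ls) ρ a E b) := by
    refine Real.continuous_exp.comp (continuous_const.mul ?_)
    unfold rectElecSum
    refine continuous_finsetSum _ fun x _ => continuous_finsetSum _ fun i _ => ?_
    exact (Complex.continuous_re.comp (Continuous.matrix_trace hρ)).comp
      ((((hc1 x).mul continuous_const).mul (hc1 _).inv).mul continuous_const)
  have hEi : Integrable (fun E : RectTorusSite Ls → G => Real.exp (J * rectElecSum (Ls := Ls) ρ a E b))
      (Measure.pi fun _ : RectTorusSite Ls => haarProbability G) :=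
    hEc.integrable_of_hasCompactSupport (HasCompactSupport.of_compactSpace _)
  set M : ℝ := ∫ E, Real.exp (J * rectElecSum (Ls := Ls) ρ a E b)
    ∂(Measure.pi fun _ : RectTorusSite Ls => haarProbability G) with hM
  have hMhi : M ≤ Real.exp (|J| * n * N) := by
    have h := integral_mono hEi (integrable_const (Real.exp (|J| * n * N)))
      fun E => Real.exp_le_exp.2 (abs_le.1 (hEint E)).2
    simp only [integral_const, smul_eq_mul, probReal_univ, one_mul] at h
    exact h
  have hMlo : Real.exp (-(|J| * n * N)) ≤ M := by
    have h := integral_mono (integrable_const (Real.exp (-(|J| * n * N)))) hEi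
      fun E => Real.exp_le_exp.2 (abs_le.1 (hEint E)).1
    simp only [integral_const, smul_eq_mul, probReal_univ, one_mul] at h
    exact h
  have hK : rectSliceKernel (Ls := Ls) ρ J J a b =
      Real.exp (J / 2 * rectMagSum (Ls := Ls) ρ a) * M * Real.exp (J / 2 * rectMagSum (Ls := Ls) ρ b) := rfl
  set x : ℝ := |J| * n * (P + N) with hx
  have hx0 : 0 ≤ x := by rw [hx]; positivity
  -- upper bound `K ≤ e^{x}` and lower bound `e^{-x} ≤ K`
  have hM0 : 0 ≤ M := (Real.exp_pos _).le.trans hMlo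
  have hKhi : rectSliceKernel (Ls := Ls) ρ J J a b ≤ Real.exp x := by
    rw [hK]
    calc Real.exp (J / 2 * rectMagSum (Ls := Ls) ρ a) * M * Real.exp (J / 2 * rectMagSum (Ls := Ls) ρ b)
        ≤ Real.exp (|J| * n * P / 2) * Real.exp (|J| * n * N) * Real.exp (|J| * n * P / 2) :=
          mul_le_mul (mul_le_mul (Real.exp_le_exp.2 (abs_le.1 (hm a)).2) hMhi hM0 (Real.exp_pos _).le)
            (Real.exp_le_exp.2 (abs_le.1 (hm b)).2) (Real.exp_pos _).le
            (mul_nonneg (Real.exp_pos _).le (Real.exp_pos _).le)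
      _ = Real.exp x := by rw [← Real.exp_add, ← Real.exp_add, hx]; ring_nf
  have hKlo : Real.exp (-x) ≤ rectSliceKernel (Ls := Ls) ρ J J a b := by
    rw [hK]
    calc Real.exp (-x) = Real.exp (-(|J| * n * P / 2)) * Real.exp (-(|J| * n * N)) * Real.exp (-(|J| * n * P / 2)) := by
          rw [← Real.exp_add, ← Real.exp_add, hx]; ring_nf
      _ ≤ Real.exp (J / 2 * rectMagSum (Ls := Ls) ρ a) * M * Real.exp (J / 2 * rectMagSum (Ls := Ls) ρ b) :=
          mul_le_mul (mul_le_mul (Real.exp_le_exp.2 (abs_le.1 (hm a)).1) hMlo (Real.exp_pos _).le (Real.exp_pos _).le)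
            (Real.exp_le_exp.2 (abs_le.1 (hm b)).1) (Real.exp_pos _).le
            (mul_nonneg (Real.exp_pos _).le hM0)
  -- `|K − 1| ≤ e^{x} − 1` (using `e^{x} + e^{-x} ≥ 2`)
  have hcosh : 1 - Real.exp (-x) ≤ Real.exp x - 1 := by
    have h1 : Real.exp x * Real.exp (-x) = 1 := by rw [← Real.exp_add, add_neg_cancel, Real.exp_zero]
    nlinarith [Real.exp_pos x, Real.exp_pos (-x), sq_nonneg (Real.exp x - 1)]
  rw [hx] at hKhi hKlo hcosh
  exact abs_sub_le_iff.2 ⟨by linarith, by linarith⟩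

/-- **`‖Tψ − ⟪1,ψ⟫1‖ ≤ (e^{|J| n (#P+N)} − 1)‖ψ‖`**: the transfer operator is within `e^{|J| n (#P+N)} − 1` (operator norm)
of the rank-one projection onto the constants (`Tψ − ⟪1,ψ⟫1 = ∫ (K − 1)ψ`, `(∫|ψ|)² ≤ ∫ψ²`). [folklore] -/
theorem norm_rectTubeTransferOperator_sub_rankOne_le (hρ : Continuous ρ) (hρu : ∀ g, ρ g ∈ Matrix.unitaryGroup (Fin n) ℂ)
    (ψ : Lp ℝ 2 (rectSliceMeasure G Ls)) :
    ‖rectTubeTransferOperator ρ J Ls ψ -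
        (@inner ℝ _ _ (Lp.const 2 (rectSliceMeasure G Ls) (1 : ℝ)) ψ) • Lp.const 2 (rectSliceMeasure G Ls) (1 : ℝ)‖ ≤
      (Real.exp (|J| * n * (Fintype.card (RectTorusSite Ls) * Fintype.card {p : Fin k × Fin k // p.1 < p.2} +
        Fintype.card (RectTorusSite Ls × Fin k))) - 1) * ‖ψ‖ := by
  set η : ℝ := Real.exp (|J| * n * (Fintype.card (RectTorusSite Ls) * Fintype.card {p : Fin k × Fin k // p.1 < p.2} +
        Fintype.card (RectTorusSite Ls × Fin k))) - 1 with hη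
  have hη0 : 0 ≤ η := by
    rw [hη, sub_nonneg]
    exact Real.one_le_exp (by positivity)
  set one : Lp ℝ 2 (rectSliceMeasure G Ls) := Lp.const 2 (rectSliceMeasure G Ls) (1 : ℝ) with hone
  set d := rectTubeTransferOperator ρ J Ls ψ - (@inner ℝ _ _ one ψ) • one with hd
  have hψi : Integrable (fun b => (ψ : RectSlice Ls G → ℝ) b) (rectSliceMeasure G Ls) :=
    (Lp.memLp ψ).integrable one_le_two
  -- `⟪1, ψ⟫ = ∫ ψ`
  have hinner : @inner ℝ _ _ one ψ = ∫ b, ψ b ∂(rectSliceMeasure G Ls) := by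
    rw [inner_eq_integral]
    refine integral_congr_ae ?_
    filter_upwards [Lp.coeFn_const 2 (rectSliceMeasure G Ls) (1 : ℝ)] with b hb
    rw [← hone] at hb
    rw [hb, Function.const_apply, one_mul]
  -- the a.e. formula `d(a) = ∫ (K(a,b) − 1) ψ(b) db`
  have hKi : ∀ a, Integrable (fun b => rectSliceKernel (Ls := Ls) ρ J J a b * ψ b) (rectSliceMeasure G Ls) := by
    intro a
    obtain ⟨C, hC⟩ := exists_rectSliceKernel_le (Ls := Ls) ρ hρ J J
    refine hψi.bdd_mul ?_ (Eventually.of_forall fun b => hC a b)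
    exact ((continuous_rectSliceKernel (Ls := Ls) ρ hρ J J).comp
      (Continuous.prodMk continuous_const continuous_id)).aestronglyMeasurable
  have hdae : (d : RectSlice Ls G → ℝ) =ᵐ[rectSliceMeasure G Ls]
      fun a => ∫ b, (rectSliceKernel (Ls := Ls) ρ J J a b - 1) * ψ b ∂(rectSliceMeasure G Ls) := by
    filter_upwards [Lp.coeFn_sub (rectTubeTransferOperator ρ J Ls ψ) ((@inner ℝ _ _ one ψ) • one),
      rectTubeTransferOperator_ae_eq J Ls hρ ψ, Lp.coeFn_smul (@inner ℝ _ _ one ψ) one,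
      Lp.coeFn_const 2 (rectSliceMeasure G Ls) (1 : ℝ)] with a ha hTa hsa h1a
    rw [hd, ha, Pi.sub_apply, hTa, hsa, Pi.smul_apply, ← hone] at *
    rw [h1a, Function.const_apply, smul_eq_mul, mul_one, hinner]
    simp_rw [sub_mul, one_mul]
    rw [integral_sub (hKi a) hψi]
  -- pointwise `|d(a)| ≤ η ∫|ψ|`
  have hpt : ∀ a, |∫ b, (rectSliceKernel (Ls := Ls) ρ J J a b - 1) * ψ b ∂(rectSliceMeasure G Ls)| ≤
      η * ∫ b, |ψ b| ∂(rectSliceMeasure G Ls) := by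
    intro a
    rw [← integral_const_mul]
    refine (abs_integral_le_integral_abs).trans (integral_mono_of_nonneg (Eventually.of_forall fun b => abs_nonneg _)
      (hψi.abs.const_mul η) (Eventually.of_forall fun b => ?_))
    dsimp only
    rw [abs_mul]
    exact mul_le_mul_of_nonneg_right (abs_rectSliceKernel_sub_one_le ρ J hρ hρu a b) (abs_nonneg _)
  -- integrate the square
  have hI0 : 0 ≤ ∫ b, |ψ b| ∂(rectSliceMeasure G Ls) := integral_nonneg fun b => abs_nonneg _
  have hsq : ‖d‖ ^ 2 ≤ (η * ‖ψ‖) ^ 2 := by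
    rw [norm_sq_eq_integral_sq]
    calc ∫ a, (d a) ^ 2 ∂(rectSliceMeasure G Ls)
        ≤ ∫ a, (η * ∫ b, |ψ b| ∂(rectSliceMeasure G Ls)) ^ 2 ∂(rectSliceMeasure G Ls) := by
          refine integral_mono_ae (Lp.memLp d).integrable_sq (integrable_const _) ?_
          filter_upwards [hdae] with a ha
          rw [ha]
          have h := hpt a
          have h2 : 0 ≤ η * ∫ b, |ψ b| ∂(rectSliceMeasure G Ls) := mul_nonneg hη0 hI0
          rw [← sq_abs]
          exact pow_le_pow_left₀ (abs_nonneg _) h 2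
      _ = (η * ∫ b, |ψ b| ∂(rectSliceMeasure G Ls)) ^ 2 := by
          rw [integral_const, smul_eq_mul, probReal_univ, one_mul]
      _ ≤ (η * ‖ψ‖) ^ 2 := by
          rw [mul_pow, mul_pow]
          refine mul_le_mul_of_nonneg_left ?_ (sq_nonneg _)
          rw [norm_sq_eq_integral_sq]
          exact sq_integral_abs_le_integral_sq ψ
  exact (pow_le_pow_iff_left₀ (norm_nonneg _) (mul_nonneg hη0 (norm_nonneg _)) two_ne_zero).1 hsq

/-- `2 − e^{|J| n (#P+N)} ≤ ‖T‖` (the rank-one approximation; useful when the bracket is small). [folklore] -/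
theorem two_sub_exp_le_norm_rectTubeTransferOperator (hρ : Continuous ρ) (hρu : ∀ g, ρ g ∈ Matrix.unitaryGroup (Fin n) ℂ) :
    2 - Real.exp (|J| * n * (Fintype.card (RectTorusSite Ls) * Fintype.card {p : Fin k × Fin k // p.1 < p.2} +
        Fintype.card (RectTorusSite Ls × Fin k))) ≤ ‖rectTubeTransferOperator ρ J Ls‖ := by
  have hone : ‖Lp.const 2 (rectSliceMeasure G Ls) (1 : ℝ)‖ = 1 := by
    rw [Lp.norm_const' (μ := rectSliceMeasure G Ls) (p := 2) (c := (1 : ℝ)) two_ne_zero ENNReal.ofNat_ne_top, norm_one,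
      probReal_univ, Real.one_rpow, mul_one]
  have h := one_sub_le_norm_of_near_rankOne (rectTubeTransferOperator ρ J Ls) hone
    (norm_rectTubeTransferOperator_sub_rankOne_le ρ J hρ hρu)
  linarith

end Gap

end Summit.Ventures.YMGap.FlowData
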